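import Summits.QuantumFields.YangMills.Theorems.UnitScaleTiltProp7FlatGaugeProjectorTower
import Literature.MathematicalPhysics.QuantumFieldTheory.Balaban1983to89.B9Eq344LocalGradientFlat
import Literature.MathematicalPhysics.QuantumFieldTheory.Balaban1983to89.B9Eq343LocalHolderFlat
import HarnessLib

/-!
# Route `UnitScaleTilt`, crux K1 «MinimiserStabilityRegPr» (stmt-QuantumFields-19200), EX face after S45 — **(L3′b)-GRAD FILE (G1-0): THE FLAT MEMBER DICTIONARY —
# THE LOCAL η-SCALE GRADIENT AND HÖLDER ESTIMATES FOR THE FLAT MASSIVE EQUATION `(Δ^η_1 + 1)u = D*_1 f` AT THE T³ MEMBER, READ OFF lit ✓`B9Eq344LocalGradientFlat.localGradient_flat_P`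
# ∕ lit ✓`B9Eq343LocalHolderFlat.localHolder_flat_P` (general torus `TSite d P`, any scale) through ✓`covLapSite_eq` (`rfl`) and ✓`adBg_one`** (★p1 g25 CHAIR WORD №3, 2026-08-30 04:47Z,
# on w5 g14's LOCATE-L3B-GRAD d17c23b9 = 19200 evidence #46: «(G1-0) a flat-member DICTIONARY file [S]»)

Cell `ym3-torus` (HUMAN RULING D-0037; rung R3 = SU(2) YM₃ on T³ — NOT d = 4, NOT infinite volume, NOT a mass gap, NOT Clay).  Width seat `ym-ust-19200-w5` (gen 14).
THEOREMS ONLY (0 `def`, 0 `sorry`, default heartbeats); `--supports stmt-QuantumFields-19200 --as helper`; count-neutral.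

WHY.  After S45 the EX face keeps ten sup-norm∕pointwise print rows of [Balaban1985BackgroundPropagators] §3; their VALUE halves go through the Kato bootstrap (V1 ✓p761229, V2, V3 ✓p761484),
their GRADIENT halves (`h349` via `Dψ_y`, the `|∇·|₍₋₂₎` parts of `norm_G`∕`norm_H₁`∕`norm_Hπ`, `h88`) through an interior `W^{1,∞}` estimate at scale `ℓ = L^{K−n}`.  The FLAT core of
that estimate, WITH its torus transfer, is ALREADY in the tree (pub-balaban NE9 gen 94∕95): lit ✓`localGradient_flat_P` ∕ ✓`localHolder_flat_P` on every torus `TSite d P`, for the operator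
`covLaplaceSiteK t id id + 1` with divergence-form data `covDivL2K ℂ c₀ t id f`.  At the member's flat background these ARE the member's letters: ✓`covLapSite_eq` gives
`covLapSite F n K c₀ U₀ = covLaplaceSiteK η⁻¹ (adBg F K U₀) (adBgInv F K U₀)` by `rfl`, `DstarL2 F n K c₀ U₀ = covDivL2K ℂ c₀ η⁻¹ (adBgInv F K U₀)` by `rfl`, and ✓`adBg_one` kills the transporters at
`U₀ = 1`.  THIS FILE is that dictionary — nothing else; the CURVED member (covariant perturbation in divergence form (G1-1..3), the η-scale modulus (★) of the axial-gauge representative) is the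
sequel (px19 g12 ∕ the chair's book).
WHAT IS PROVED (ns `Summit.QuantumFields.YangMills.Theorems.Prop7FlatMemberLocalGradient`).
* §1 `covLapSite_one_eq`, `DstarL2_one_eq` (over ✓`Prop7FlatGaugeProjectorTower.adBg_one_eq`∕`adBgInv_one_eq`) (the flat member operators ARE the lit flat operators with real quotient `ℓ = L^{K−n}`),
  `one_le_ell` (`1 ≤ L^{K−n}`).
* §2 ★★ `exists_localGradient_flat_member` — `∃ Cg ≥ 0` (a function of `d = 3` only) such that for EVERY family `F`, heights `n ≤ K`, weight `c₀ > 0`, every `u f` with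
  `covLapSite F n K c₀ 1 u + u = DstarL2 F n K c₀ 1 f`, every centre `x`: a local sup bound `‖u(y)‖ ≤ M_u` on the `tdist`-ball of radius `4ℓ` about `x` and a local η-`½`-Hölder modulus
  `‖f(y′,μ) − f(y,μ)‖ ≤ H_f·(tdist(y,y′)∕ℓ)^{½}` of the data there give `ℓ·‖u(x+e_μ) − u(x)‖ ≤ Cg·(M_u + H_f)` — i.e. `‖(∇^η_1 u)(⟨x,μ⟩)‖ ≤ Cg(M_u + H_f)`, K-UNIFORM.
* §3 ★★ `exists_localHolder_flat_member` — the Hölder twin: `‖u(x′) − u(x)‖ ≤ Ch·(M_u + M_f)·(tdist(x,x′)∕ℓ)^{½}` for `tdist(x,x′) ≤ ℓ` from local sup bounds of `u` and `f`.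
HONEST SCOPE.  A dictionary over landed lit (no new analysis); FLAT background only; nothing of the curved rows, (★), the ten print rows, `hT`, `hGF`, EX `stub_existenceMinimalOrbit` or the crux
is proved here; the Yang–Mills mass gap is NOT proved.

References: T. Bałaban, CMP **96** (1984) 223–250 [Balaban1984PropagatorsII] ((1.9) p.226); CMP **99** (1985) 389–434 [Balaban1985BackgroundPropagators] (Thm 3.1 (3.43)–(3.44) p.398, (3.3)∕(3.8)
pp.391–392, (3.23) p.394); M. Giaquinta, *Multiple integrals in the calculus of variations and nonlinear elliptic systems* (1983) [Giaquinta1984] (Ch. III §1–§3) — the folklore behind the lit files.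
-/

set_option autoImplicit false

noncomputable section

open scoped InnerProductSpace ComplexConjugate BigOperators

namespace Summit.QuantumFields.YangMills.Theorems.Prop7FlatMemberLocalGradient

open Literature.MathematicalPhysics.QuantumFieldTheory.Balaban1983to89
open Literature.MathematicalPhysics.QuantumFieldTheory.Balaban1983to89.T3ContinuumYM3Torus
open B4Sect5Torus (TSite tdist)
open B9SectCLatticeCarrier (Bond bpos shift unshift)
open B9Eq311L2Pairing (WL2)
open B11Eq103H1Complex (SiteL2K BondL2K covDivL2K covLaplaceSiteK)
open B9Eq344LocalGradientFlat (gradient_flat_core localGradient_flat_P)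
open B9Eq343LocalHolderFlat (holder_flat_core localHolder_flat_P)
open T3SectALandauChart (eta eta_pos)
open Summit.QuantumFields.YangMills.Theorems.Prop7SectET3Transport (periodsT3)
open Summit.QuantumFields.YangMills.Theorems.Prop7SectET3HilbertLetters (W₂ adBg adBgInv DstarL2 covLapSite covLapSite_eq)
open Summit.QuantumFields.YangMills.Theorems.Prop7FlatGaugeProjectorTower (adBg_one_eq adBgInv_one_eq)

/-! ## §1 The flat member operators are the lit flat operators with real quotient `ℓ = L^{K−n}` -/

section Dictionary

variable (F : T3Family) (n K : ℕ) (c₀ : ℝ) [Fact (0 < c₀)]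

-- `R(1) = id`, `R(1)⁻¹ = id` as functions: ✓`Prop7FlatGaugeProjectorTower.adBg_one_eq` ∕ `adBgInv_one_eq` (landed, reused BY NAME — gate dedup).

/-- `η⁻¹ = ℓ = L^{K−n}` as a complex scalar: `((η : ℝ) : ℂ)⁻¹ = ((L^{K−n} : ℕ) : ℝ)`. [cite: Balaban1985BackgroundPropagators, (3.1) p.390] -/
theorem inv_eta_cast : (((eta F n K : ℝ) : ℂ))⁻¹ = ((((F.L ^ (K - n) : ℕ) : ℝ) : ℝ) : ℂ) := by
  rw [← Complex.ofReal_inv, eta, inv_pow, inv_inv]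
  push_cast
  rfl

/-- **THE FLAT MEMBER LAPLACIAN IS THE LIT FLAT LAPLACIAN**: `Δ^η_1 = covLaplaceSiteK ℓ id id` (✓`covLapSite_eq` + ✓`adBg_one`). [cite: Balaban1985BackgroundPropagators, (3.23) p.394] -/
theorem covLapSite_one_eq :
    covLapSite F n K c₀ (1 : GaugeField (F.P K) 0 (Matrix.specialUnitaryGroup (Fin 2) ℂ))
      = covLaplaceSiteK (((((F.L ^ (K - n) : ℕ) : ℝ) : ℝ) : ℂ)) (fun _ : Bond 3 (periodsT3 F K) => (LinearMap.id : W₂ →ₗ[ℂ] W₂)) (fun _ => LinearMap.id) := by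
  rw [covLapSite_eq, adBg_one_eq, adBgInv_one_eq, inv_eta_cast]

/-- **THE FLAT MEMBER DIVERGENCE IS THE LIT FLAT DIVERGENCE**: `D*_1 = covDivL2K ℂ c₀ ℓ id` (`rfl` + ✓`adBg_one`). [cite: Balaban1985BackgroundPropagators, (3.8) p.392] -/
theorem DstarL2_one_eq :
    DstarL2 F n K c₀ (1 : GaugeField (F.P K) 0 (Matrix.specialUnitaryGroup (Fin 2) ℂ))
      = covDivL2K ℂ c₀ (((((F.L ^ (K - n) : ℕ) : ℝ) : ℝ) : ℂ)) (fun _ : Bond 3 (periodsT3 F K) => (LinearMap.id : W₂ →ₗ[ℂ] W₂)) := by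
  show covDivL2K ℂ c₀ (((eta F n K : ℝ) : ℂ)⁻¹) (adBgInv F K 1) = _
  rw [adBgInv_one_eq, inv_eta_cast]

/-- `1 ≤ ℓ = L^{K−n}` (`L > 1`). [cite: Balaban1985BackgroundPropagators, (3.1) p.390] -/
theorem one_le_ell : 1 ≤ F.L ^ (K - n) := Nat.one_le_pow _ _ (by have := F.hL.2; omega)

/-- `(ℓ : ℝ) = L^{K−n}` cast bookkeeping. [cite: Balaban1985BackgroundPropagators, (3.1) p.390] -/
theorem ell_cast : (((F.L ^ (K - n) : ℕ) : ℝ)) = (F.L : ℝ) ^ (K - n) := by push_cast; rfl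

end Dictionary

/-! ## §2 ★★ The local gradient estimate at the flat member -/

/-- ★★ **THE LOCAL η-SCALE GRADIENT ESTIMATE AT THE FLAT T³ MEMBER** (`Hloc∇` of lit ✓`B9Eq344LocalGradientFlat`, read through §1).  There is `Cg ≥ 0` (a function of the dimension `3` only)
such that for every family `F`, heights `n, K`, weight `c₀ > 0`, every `u f` with `(Δ^η_1 + 1)u = D*_1 f` (`covLapSite F n K c₀ 1 u + u = DstarL2 F n K c₀ 1 f`) and every centre `x`: if
`‖u(y)‖ ≤ M_u` on the `tdist`-ball of radius `4ℓ` about `x` (`ℓ = L^{K−n}`) and `‖f(y′,μ) − f(y,μ)‖ ≤ H_f·(tdist(y,y′)∕ℓ)^{½}` for bond positions in that ball, then for every direction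
`ℓ·‖u(x + e_μ) − u(x)‖ ≤ Cg·(M_u + H_f)` — the η-gradient of `u` at `x` is bounded by the local sup of `u` and the local η-Hölder modulus of the data, UNIFORMLY IN `K − n`.
[cite: Balaban1984PropagatorsII, (1.9) p.226; Balaban1985BackgroundPropagators, Thm 3.1 (3.44) p.398] -/
theorem exists_localGradient_flat_member : ∃ Cg : ℝ, 0 ≤ Cg ∧
    ∀ (F : T3Family) (n K : ℕ) (c₀ : ℝ) [Fact (0 < c₀)]
      (u : SiteL2K ℂ 3 (periodsT3 F K) c₀ W₂) (f : BondL2K ℂ 3 (periodsT3 F K) c₀ W₂) (x : TSite 3 (periodsT3 F K)) (Mu Hf : ℝ), 0 ≤ Mu → 0 ≤ Hf →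
      covLapSite F n K c₀ 1 u + ((1 : ℝ) : ℂ) • u = DstarL2 F n K c₀ 1 f →
      (∀ y, tdist (periodsT3 F K) x y ≤ 4 * ((F.L : ℝ) ^ (K - n)) → ‖WL2.equiv ℂ (fun _ : TSite 3 (periodsT3 F K) => c₀) W₂ u y‖ ≤ Mu) →
      (∀ (y y' : TSite 3 (periodsT3 F K)) (μ : Fin 3), tdist (periodsT3 F K) x y ≤ 4 * ((F.L : ℝ) ^ (K - n)) → tdist (periodsT3 F K) x y' ≤ 4 * ((F.L : ℝ) ^ (K - n)) →
        ‖WL2.equiv ℂ (fun _ : Bond 3 (periodsT3 F K) => c₀) W₂ f (y', μ) - WL2.equiv ℂ (fun _ : Bond 3 (periodsT3 F K) => c₀) W₂ f (y, μ)‖ ≤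
          Hf * (tdist (periodsT3 F K) y y' / ((F.L : ℝ) ^ (K - n))) ^ ((1 : ℝ) / 2)) →
      ∀ μ : Fin 3, (F.L : ℝ) ^ (K - n) * ‖WL2.equiv ℂ (fun _ : TSite 3 (periodsT3 F K) => c₀) W₂ u (shift μ x) - WL2.equiv ℂ (fun _ : TSite 3 (periodsT3 F K) => c₀) W₂ u x‖
        ≤ Cg * (Mu + Hf) := by
  obtain ⟨C, hC0, hC⟩ := gradient_flat_core (d := 3) (by norm_num) (W := W₂)
  refine ⟨C + 4, by linarith, ?_⟩
  intro F n K c₀ _ u f x Mu Hf hMu hHf hu hbu hbf μ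
  have hell := ell_cast F n K
  have h := localGradient_flat_P (d := 3) hC0 hC (periodsT3 F K) (one_le_ell F n K) (t := ((F.L ^ (K - n) : ℕ) : ℝ)) rfl u f x hMu hHf
    (by rw [← covLapSite_one_eq F n K c₀, ← DstarL2_one_eq F n K c₀]; exact hu)
    (fun y hy => hbu y (by rwa [hell] at hy)) (fun y y' ν hy hy' => by
      have := hbf y y' ν (by rwa [hell] at hy) (by rwa [hell] at hy')
      rwa [hell]) μ
  rwa [hell] at h

/-! ## §3 ★★ The local Hölder estimate at the flat member -/

/-- ★★ **THE LOCAL η-SCALE HÖLDER ESTIMATE AT THE FLAT T³ MEMBER** (`Hloc` of lit ✓`B9Eq343LocalHolderFlat`, read through §1).  There is `Ch ≥ 0` (dimension `3` only) such that for every `F, n, K, c₀`,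
every `u f` with `covLapSite F n K c₀ 1 u + u = DstarL2 F n K c₀ 1 f` and every centre `x`: if `‖u(y)‖ ≤ M_u` on the `tdist`-ball of radius `4ℓ` about `x` and `‖f(b)‖ ≤ M_f` for bonds positioned
in that ball, then `‖u(x′) − u(x)‖ ≤ Ch·(M_u + M_f)·(tdist(x,x′)∕ℓ)^{½}` for every `x′` with `tdist(x,x′) ≤ ℓ` — BOUNDED data suffice (no modulus), UNIFORMLY IN `K − n`.
[cite: Balaban1984PropagatorsII, (1.9) p.226; Balaban1985BackgroundPropagators, Thm 3.1 (3.43) p.398] -/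
theorem exists_localHolder_flat_member : ∃ Ch : ℝ, 0 ≤ Ch ∧
    ∀ (F : T3Family) (n K : ℕ) (c₀ : ℝ) [Fact (0 < c₀)]
      (u : SiteL2K ℂ 3 (periodsT3 F K) c₀ W₂) (f : BondL2K ℂ 3 (periodsT3 F K) c₀ W₂) (x : TSite 3 (periodsT3 F K)) (Mu Mf : ℝ), 0 ≤ Mu → 0 ≤ Mf →
      covLapSite F n K c₀ 1 u + ((1 : ℝ) : ℂ) • u = DstarL2 F n K c₀ 1 f →
      (∀ y, tdist (periodsT3 F K) x y ≤ 4 * ((F.L : ℝ) ^ (K - n)) → ‖WL2.equiv ℂ (fun _ : TSite 3 (periodsT3 F K) => c₀) W₂ u y‖ ≤ Mu) →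
      (∀ b : Bond 3 (periodsT3 F K), tdist (periodsT3 F K) x (bpos b) ≤ 4 * ((F.L : ℝ) ^ (K - n)) → ‖WL2.equiv ℂ (fun _ : Bond 3 (periodsT3 F K) => c₀) W₂ f b‖ ≤ Mf) →
      ∀ x' : TSite 3 (periodsT3 F K), tdist (periodsT3 F K) x x' ≤ (F.L : ℝ) ^ (K - n) →
        ‖WL2.equiv ℂ (fun _ : TSite 3 (periodsT3 F K) => c₀) W₂ u x' - WL2.equiv ℂ (fun _ : TSite 3 (periodsT3 F K) => c₀) W₂ u x‖
          ≤ Ch * (Mu + Mf) * (tdist (periodsT3 F K) x x' / ((F.L : ℝ) ^ (K - n))) ^ ((1 : ℝ) / 2) := by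
  obtain ⟨C, hC0, hC⟩ := holder_flat_core (d := 3) (by norm_num) (W := W₂)
  refine ⟨C + 4, by linarith, ?_⟩
  intro F n K c₀ _ u f x Mu Mf hMu hMf hu hbu hbf x' hxx'
  have hell := ell_cast F n K
  have h := localHolder_flat_P (d := 3) hC0 hC (periodsT3 F K) (one_le_ell F n K) (t := ((F.L ^ (K - n) : ℕ) : ℝ)) rfl u f x hMu hMf
    (by rw [← covLapSite_one_eq F n K c₀, ← DstarL2_one_eq F n K c₀]; exact hu)
    (fun y hy => hbu y (by rwa [hell] at hy)) (fun b hb => hbf b (by rwa [hell] at hb)) x' (by rwa [hell])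
  rwa [hell] at h

end Summit.QuantumFields.YangMills.Theorems.Prop7FlatMemberLocalGradient

end
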